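import Literature.Geometry.Kaehler.ComplexTorusWeilTypeUnitaryGroupDet
import Literature.Geometry.Kaehler.ComplexTorusWeilHodgeCyclesHodgeGroup
import HarnessLib

/-!
# Fixing the Weil classes forces `K`-linearity: `Stab(W_K) ⊆ GL_K(V)`, hence `Stab(W_K) = SL_K(V)`
# (Moonen–Zarhin 1998, Lemma (12)(2))

Layer `Literature/Geometry/Kaehler`, namespace `Literature.Geometry.Kaehler.ComplexTorus` (torus level) and
`Literature.Analysis.Complex.WeilOperator` (operator level); lane `lit-hodgefound` (Track 2 foundations
library), Layer A4, self-proposed row «(#3)⁺ · (#2 FILE B)⁺ · A4-40⁺ — Moonen–Zarhin 1998 Lemma (12)(2): "If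
`g ∈ Gl_ℚ(V)` acts as the identity on `W_F` then `g` is `F`-linear, hence `g ∈ Sl_F(V)`"» of
`run/shared/lean/pub/lit-hodgefound/SKELETON.md`. Sequel of `ComplexTorusWeilHodgeCyclesHodgeGroup.lean`
(row #3: `formsStabilizer_weilHodgeCycles_eq` — the pointwise stabiliser of `W_K` in `SL(V_ℝ)` is the
pointwise stabiliser of the line `⋀^{2n} U₊`) and `ComplexTorusWeilTypeUnitaryGroupDet.lean` (row #2 FILE B:
the eigen-letters `u_j`, `pqLetter_plus_eigenBasis`, and for Weil type the matrix `letterMatrix` of `r^*|_W`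
with `forall_compContinuousLinearMap_eq_iff_det`). CONCRETE torus level, model-free: `X = E/Φ(ℤ^ι)`,
`K = ℚ(α)`, `α ∈ End_ℚ(X)`, `α² = -d < 0`; `W_K = weilHodgeCycles Φ α d n`; `R(ℝ) = matCentralizer α` (the
`K ⊗ ℝ`-linear elements of `SL(V_ℝ)`); groups through REAL POINTS in `SL(V_ℝ) = SL_ι(ℝ)` — the printed
statement is for `g ∈ Gl_ℚ(V)`; its proof (a determinant identity) works verbatim over `ℝ`, which is the
form proved here (and implies the rational one).

## Source, verbatim

B. J. J. Moonen, Yu. G. Zarhin, *Weil classes on abelian varieties*, J. reine angew. Math. 496 (1998) 83–92,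
held `paper:arxiv-alg-geom_9612017`, paragraph (12) of the arXiv numbering (p. 3, L15–L57): "Lemma. (1) The
space `W_F = ⋀^r_F V` can naturally be identified with a subspace of `⋀^r_ℚ V`. (2) If `g ∈ Gl_ℚ(V)` acts as
the identity on `W_F` then `g` is `F`-linear, hence `g ∈ Sl_F(V)`. Proof. […] (2) Choose an `F`-basis for
`V_X`. This gives an isomorphism `F ≅ Hom_F(⋀^r_F V_X^∨, F)` by sending `f ∈ F` to the functional
`t_1 ∧_F … ∧_F t_r ↦ f · det_F(t_1, …, t_r)`. Suppose `g ∈ Gl_ℚ(V_X)` acts trivially on `W_F`. […]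
`det_F(t_1, …, t_r) = det_F(g·t_1, …, g·t_r)` for all `t_1, …, t_r ∈ V_X^∨`. For `f ∈ F` this gives the
identity `det_F(g·(f t_1), g·t_2, …, g·t_r) = f · det_F(g·t_1, …, g·t_r) = det_F(f (g·t_1), g·t_2, …, g·t_r)`,
and (2) readily follows from this."

## Rendering and proof followed (theorems only; no definition, no named fact, net debt 0)

`det_F ⊗_σ ℂ` on `r = 2n` covectors is the tree's generator `Ω₊ = u_{e 0} ∧ ⋯ ∧ u_{e (k-1)}` of the line
`⋀^k U₊` (`WeilOperator.plusForm`, `k = dim_ℂ E`; `u_j` the `√-d`-eigen-letters of FILE B), and "acts as the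
identity on `W_F`" is membership in FILE A's pointwise stabiliser `formsStabilizer Φ ↑W_K`, which row #3
identified with `formsStabilizer Φ ↑(⋀^{2n} U₊)`.
* §1 (operator level, `T` complex-linear with `T² = -d`): `plusForm_apply_update_eigenTuple`
  (`Ω₊(b_1, …, x, …, b_k) = u_i(x)` — one column of the determinant replaced, Cramer on the identity),
  `eq_zero_of_forall_pqLetter_plus_eq_zero` (the letters separate points),
  `eq_zero_of_forall_plusForm_update_eq_zero` (the kernel of the decomposable top form `Ω₊` is `0`), and the
  MAIN LEMMA **`eq_of_plusForm_mem_slotEigenForms`: a real operator `S` acting by `√-d` in every slot of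
  `Ω₊` IS `T`** — the printed step "`det_F(g·(f t_1), g·t_2, …) = det_F(f (g·t_1), g·t_2, …)` ⟹ `g(f t) = f(g t)`"
  (both `S` and `T` act by `√-d` in a slot of `Ω₊`, so `Ω₊((S - T)x, b_2, …) = 0` for all `x`).
* §2 (torus level): **`formsStabilizer_slotEigenForms_le_matCentralizer`** — if `ρ(M)^*` fixes `⋀^{2n} U₊`
  pointwise then `M` commutes with `α ⊗ 1` (transport `Ω₊` along `ρ(M⁻¹)`: it is slot-eigen for
  `ρ(M α M⁻¹)`, hence `M α M⁻¹ = α`); **`formsStabilizer_weilHodgeCycles_le_matCentralizer`** = Lemma (12)(2)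
  on `W_K` ("acts as the identity on `W_F` ⟹ `F`-linear"); `formsStabilizer_weilHodgeCycles_eq_inf`
  (`Stab(W_K) = R(ℝ) ∩ Stab(⋀^{2n} U₊)`, i.e. `SL_K(V)(ℝ)` read on the line, no signature condition); and
  "hence `g ∈ Sl_F(V)`" with the explicit determinant for a torus of Weil type (FILE B `letterMatrix`):
  **`IsWeilType.mem_formsStabilizer_weilHodgeCycles_iff`** (`ρ(M)^*` fixes `W_K` ⟺ `M ∈ R(ℝ)` and
  `det N(ρ(M)) = 1`), `IsWeilType.formsStabilizer_weilHodgeCycles_inf_spGroup` (`Stab(W_K) ∩ Sp(E) = SU_H(ℝ)`).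

NOT here: Lemma (12)(1) beyond A4-40's definition of `W_K` as a subspace of `H^{2n}(X, ℚ)`; CM fields
`F ≠` imaginary quadratic.

## References

* [MoonenZarhin1998WeilClasses] B. J. J. Moonen, Yu. G. Zarhin, *Weil classes on abelian varieties*,
  J. reine angew. Math. 496 (1998), Lemma (12)(2) (arXiv alg-geom/9612017 p. 3).
* [vanGeemen1994HodgeAV] B. van Geemen, *An introduction to the Hodge conjecture for abelian varieties*,
  LNM 1594 (1994), 6.9 and proof of 6.10 (`κ(r)`, `W ⊕ W̄`).
-/

noncomputable section

open scoped ComplexConjugate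
open Complex Function Module Matrix
open Literature.Analysis.Complex Literature.Analysis.Complex.WeilOperator Literature.LinearAlgebra.Alternating

/-! ## §1 The line `⋀ᵏ U₊` determines the operator -/

namespace Literature.Analysis.Complex.WeilOperator

variable {E : Type*} [NormedAddCommGroup E] [NormedSpace ℂ E] {T : E →L[ℂ] E} {d : ℝ}
  [FiniteDimensional ℂ E] (hd : 0 < d) (hT : ∀ v, T (T v) = -((d : ℂ) • v))

/-- **`Ω₊(b_{e 0}, …, x, …, b_{e (k-1)}) = u_{e i}(x)`** (`x` in slot `i`): in the determinant formula
`Ω₊(v) = det (u_{e a}(v_l))` the pairing matrix is the identity with column `i` replaced by `(u_{e a}(x))_a`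
— the functional "`t_1 ∧_F … ∧_F t_r ↦ det_F(t_1, …, t_r)`" evaluated with one free slot.
[cite: MoonenZarhin1998WeilClasses, Lemma (12)(2) (proof)] [cite: Warner1983, 2.6] -/
theorem plusForm_apply_update_eigenTuple {k : ℕ} (e : Fin k ≃ Idx T d) (i : Fin k) (x : E) :
    plusForm hd hT e (update (fun l ↦ eigenBasis hd hT (e l)) i x) = pqLetter (coordCLM hd hT) (plusWord e i) x := by
  rw [plusForm, pqWord, wedgeWord_apply, oneForm₀_apply, smul_eq_mul, mul_one]
  have hM : pairingMatrix (pqLetter (coordCLM hd hT)) (plusWord e) (update (fun l ↦ eigenBasis hd hT (e l)) i x) =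
      (1 : Matrix (Fin k) (Fin k) ℂ).updateCol i (fun a ↦ pqLetter (coordCLM hd hT) (plusWord e a) x) := by
    ext a l
    rw [pairingMatrix_apply, Matrix.updateCol_apply, update_apply]
    split_ifs with h
    · rfl
    · rw [Matrix.one_apply, plusWord, pqLetter_plus_eigenBasis]
      simp only [EmbeddingLike.apply_eq_iff_eq]
  rw [hM, ← Matrix.cramer_apply, Matrix.cramer_one]
  simp

/-- **The eigen-letters separate points**: if `u_j(x) = 0` for every `j` then `x = 0` (`u_j` is the
coordinate `dz_j` or its conjugate). [cite: vanGeemen1994HodgeAV, proof of 6.10 (the basis of `W`)] -/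
theorem eq_zero_of_forall_pqLetter_plus_eq_zero {x : E}
    (h : ∀ j : Idx T d, pqLetter (coordCLM hd hT) (j, j.isRight) x = 0) : x = 0 := by
  have hc : ∀ j, (eigenBasis hd hT).repr x j = 0 := by
    intro j
    have hj := h j
    have hco : coordCLM hd hT j x = (eigenBasis hd hT).repr x j := by
      change (eigenBasis hd hT).coord j x = _
      rw [Basis.coord_apply]
    rcases hb : j.isRight with _ | _
    · rw [hb, pqLetter_false_apply, hco] at hj
      exact hj
    · rw [hb, pqLetter_true_apply, hco, map_eq_zero] at hj
      exact hj
  exact (eigenBasis hd hT).ext_elem fun j ↦ by rw [hc j, map_zero, Finsupp.zero_apply]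

/-- **The kernel of the decomposable top form `Ω₊` is zero**: if `Ω₊(b_{e 0}, …, x, …, b_{e (k-1)}) = 0` for
every slot `i` then `x = 0`. [cite: MoonenZarhin1998WeilClasses, Lemma (12)(2) (proof)] -/
theorem eq_zero_of_forall_plusForm_update_eq_zero {k : ℕ} (e : Fin k ≃ Idx T d) {x : E}
    (h : ∀ i : Fin k, plusForm hd hT e (update (fun l ↦ eigenBasis hd hT (e l)) i x) = 0) : x = 0 :=
  eq_zero_of_forall_pqLetter_plus_eq_zero hd hT fun j ↦ by
    have hj := h (e.symm j)
    rw [plusForm_apply_update_eigenTuple] at hj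
    simpa only [plusWord, Equiv.apply_symm_apply] using hj

/-- **MAIN LEMMA — the line `⋀ᵏ U₊` determines `T`: a real operator `S` acting by `√-d` in every slot of
`Ω₊` is `T`.** Both `S` and `T` act by `√-d` in slot `i` of `Ω₊`, so `Ω₊(b_{e 0}, …, (S - T)x, …) = 0` for every
`x` and `i`, and the kernel of `Ω₊` is `0` — the printed "`det_F(g·(f t_1), g·t_2, …, g·t_r) =
det_F(f (g·t_1), g·t_2, …, g·t_r)`, and (2) readily follows from this".
[cite: MoonenZarhin1998WeilClasses, Lemma (12)(2) (proof)] -/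
theorem eq_of_plusForm_mem_slotEigenForms {k : ℕ} (e : Fin k ≃ Idx T d) {S : E →L[ℝ] E}
    (hS : plusForm hd hT e ∈ slotEigenForms S (sqrtNeg d) k) : S = T.restrictScalars ℝ := by
  have hT' := plusForm_mem_slotEigenForms hd hT e
  ext x
  rw [ContinuousLinearMap.coe_restrictScalars', ← sub_eq_zero]
  refine eq_zero_of_forall_plusForm_update_eq_zero hd hT e fun i ↦ ?_
  set b : Fin k → E := fun l ↦ eigenBasis hd hT (e l) with hb
  have h1 := hS (update b i x) i
  have h2 := hT' (update b i x) i
  rw [update_idem, update_self] at h1 h2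
  rw [ContinuousLinearMap.coe_restrictScalars'] at h2
  rw [sub_eq_add_neg, (plusForm hd hT e).map_update_add, h1, show -T x = (-1 : ℝ) • T x by simp,
    (plusForm hd hT e).map_update_smul, h2]
  simp

end Literature.Analysis.Complex.WeilOperator

/-! ## §2 Torus level: `Stab(W_K) ⊆ R(ℝ)`, `Stab(W_K) = SL_K(V)(ℝ)` -/

namespace Literature.Geometry.Kaehler

namespace ComplexTorus

variable {ι : Type*} [Fintype ι] [DecidableEq ι] {E : Type*} [NormedAddCommGroup E] [NormedSpace ℂ E]
  {Φ : (ι → ℝ) ≃L[ℝ] E} {η : E [⋀^Fin 2]→L[ℝ] ℝ} {α : Matrix ι ι ℚ} {d n : ℕ}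

omit [DecidableEq ι] in
/-- `E` is finite-dimensional over `ℂ` (it is `ℝ^ι` over `ℝ`). [folklore] -/
private theorem wcs_finiteDimensional_complex (Φ : (ι → ℝ) ≃L[ℝ] E) : FiniteDimensional ℂ E :=
  haveI : FiniteDimensional ℝ E := LinearEquiv.finiteDimensional Φ.toLinearEquiv
  Module.Finite.of_restrictScalars_finite ℝ ℂ E

/-- `ρ : M ↦ Φ M Φ⁻¹` is injective. [cite: Lange2023AbelianVarietiesComplex, §1.1.2 (the rational representation is faithful)] -/
theorem analyticRepReal_injective (Φ : (ι → ℝ) ≃L[ℝ] E) {B C : Matrix ι ι ℝ}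
    (h : analyticRepReal Φ Φ B = analyticRepReal Φ Φ C) : B = C := by
  have hx : ∀ x, B *ᵥ x = C *ᵥ x := fun x ↦
    Φ.injective (by rw [← analyticRepReal_apply Φ Φ B, ← analyticRepReal_apply Φ Φ C, h])
  have hl : Matrix.toLin' B = Matrix.toLin' C :=
    LinearMap.ext fun x ↦ by rw [Matrix.toLin'_apply, Matrix.toLin'_apply]; exact hx x
  exact Matrix.toLin'.injective hl

/-- `M⁻¹ M = 1` in `SL(V_ℝ)`, on matrices. [folklore] -/
private theorem wcs_inv_mul (M : SpecialLinearGroup ι ℝ) : (M⁻¹).1 * M.1 = 1 := by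
  rw [← Matrix.SpecialLinearGroup.coe_mul, inv_mul_cancel, Matrix.SpecialLinearGroup.coe_one]

/-- **Lemma (12)(2), real points, on the line: if `ρ(M)^*` fixes `⋀^k U₊` pointwise (`k = dim_ℂ E`) then `M`
is `K ⊗ ℝ`-linear** (`M ∈ R(ℝ)`: `M (α ⊗ 1) = (α ⊗ 1) M`). Proof: `ρ(M⁻¹)^*` fixes `Ω₊` too and intertwines
`ρ(M α M⁻¹)` with `ρ(α)`, so `Ω₊ = ρ(M⁻¹)^* Ω₊` is slot-eigen for `ρ(M α M⁻¹)`; by the main lemma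
`ρ(M α M⁻¹) = ρ(α)`. [cite: MoonenZarhin1998WeilClasses, Lemma (12)(2)] -/
theorem mem_matCentralizer_of_mem_formsStabilizer_slotEigenForms (hα : α ∈ endAlgRat Φ) (hd : 0 < d)
    (hsq : α * α = -((d : ℚ) • 1)) {k : ℕ} (hE : finrank ℂ E = k) {M : SpecialLinearGroup ι ℝ}
    (hM : M ∈ formsStabilizer Φ
      (slotEigenForms (analyticRepReal Φ Φ (α.map (Rat.cast : ℚ → ℝ))) (sqrtNeg d) k : Set (E [⋀^Fin k]→L[ℝ] ℂ))) :
    M ∈ matCentralizer α := by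
  haveI := wcs_finiteDimensional_complex Φ
  have hd' : (0 : ℝ) < d := Nat.cast_pos.2 hd
  have hT := analyticRepHom_sq_real Φ hα hsq
  have hTr : (analyticRepHom Φ ⟨α, hα⟩).restrictScalars ℝ = analyticRepReal Φ Φ (α.map (Rat.cast : ℚ → ℝ)) :=
    restrictScalars_analyticRepHom Φ hα
  set e := idxEquiv hd' hT hE with he
  have hΩ : plusForm hd' hT e ∈
      slotEigenForms (analyticRepReal Φ Φ (α.map (Rat.cast : ℚ → ℝ))) (sqrtNeg d) k := by
    rw [← hTr]; exact plusForm_mem_slotEigenForms hd' hT e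
  -- `ρ(M⁻¹)^*` fixes `Ω₊`
  have hinv : (plusForm hd' hT e).compContinuousLinearMap (analyticRepReal Φ Φ (M⁻¹).1) = plusForm hd' hT e :=
    (Subgroup.inv_mem _ hM) _ hΩ
  -- `S = ρ(M α M⁻¹)` is intertwined with `ρ(α)` by `ρ(M⁻¹)`
  set S := analyticRepReal Φ Φ (M.1 * α.map (Rat.cast : ℚ → ℝ) * (M⁻¹).1) with hS_def
  have hGS : ∀ v, analyticRepReal Φ Φ (M⁻¹).1 (S v) =
      analyticRepReal Φ Φ (α.map (Rat.cast : ℚ → ℝ)) (analyticRepReal Φ Φ (M⁻¹).1 v) := by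
    intro v
    rw [hS_def, ← ContinuousLinearMap.comp_apply, ← analyticRepReal_mul Φ Φ Φ,
      ← ContinuousLinearMap.comp_apply (analyticRepReal Φ Φ (α.map (Rat.cast : ℚ → ℝ))),
      ← analyticRepReal_mul Φ Φ Φ, ← Matrix.mul_assoc, ← Matrix.mul_assoc, wcs_inv_mul, Matrix.one_mul]
  have hS : plusForm hd' hT e ∈ slotEigenForms S (sqrtNeg d) k := by
    have h := compContinuousLinearMap_mem_slotEigenForms hGS hΩ
    rwa [hinv] at h
  have hST := eq_of_plusForm_mem_slotEigenForms hd' hT e hS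
  rw [hTr] at hST
  have hmat : M.1 * α.map (Rat.cast : ℚ → ℝ) * (M⁻¹).1 = α.map (Rat.cast : ℚ → ℝ) :=
    analyticRepReal_injective Φ hST
  rw [mem_matCentralizer_iff]
  calc M.1 * α.map (Rat.cast : ℚ → ℝ)
      = M.1 * α.map (Rat.cast : ℚ → ℝ) * ((M⁻¹).1 * M.1) := by rw [wcs_inv_mul, Matrix.mul_one]
    _ = M.1 * α.map (Rat.cast : ℚ → ℝ) * (M⁻¹).1 * M.1 := by simp only [Matrix.mul_assoc]
    _ = α.map (Rat.cast : ℚ → ℝ) * M.1 := by rw [hmat]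

/-- **`Stab(⋀^k U₊) ⊆ R(ℝ)`**: the pointwise stabiliser of the line `⋀^k U₊` (`k = dim_ℂ E`) consists of
`K ⊗ ℝ`-linear maps. [cite: MoonenZarhin1998WeilClasses, Lemma (12)(2)] -/
theorem formsStabilizer_slotEigenForms_le_matCentralizer (hα : α ∈ endAlgRat Φ) (hd : 0 < d)
    (hsq : α * α = -((d : ℚ) • 1)) {k : ℕ} (hE : finrank ℂ E = k) :
    formsStabilizer Φ (slotEigenForms (analyticRepReal Φ Φ (α.map (Rat.cast : ℚ → ℝ))) (sqrtNeg d) k :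
        Set (E [⋀^Fin k]→L[ℝ] ℂ)) ≤ matCentralizer α :=
  fun _ hM ↦ mem_matCentralizer_of_mem_formsStabilizer_slotEigenForms hα hd hsq hE hM

/-- **Moonen–Zarhin, Lemma (12)(2): "If `g` acts as the identity on `W_F` then `g` is `F`-linear"** —
at torus level on real points: the pointwise stabiliser of the Weil classes `W_K` in `SL(V_ℝ)` is contained in
`R(ℝ)` (the maps commuting with `α ⊗ 1`). [cite: MoonenZarhin1998WeilClasses, Lemma (12)(2)] -/
theorem formsStabilizer_weilHodgeCycles_le_matCentralizer (hα : α ∈ endAlgRat Φ) (hd : 0 < d)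
    (hsq : α * α = -((d : ℚ) • 1)) (hn : 0 < n) (hE : finrank ℂ E = 2 * n) :
    formsStabilizer Φ (weilHodgeCycles Φ α d n : Set (E [⋀^Fin (2 * n)]→L[ℝ] ℂ)) ≤ matCentralizer α := by
  rw [formsStabilizer_weilHodgeCycles_eq hα hd hsq hn hE]
  exact formsStabilizer_slotEigenForms_le_matCentralizer hα hd hsq hE

/-- **`Stab(W_K) = R(ℝ) ∩ Stab(⋀^{2n} U₊) = SL_K(V)(ℝ)`** (no signature condition): fixing the Weil classes is
being `K`-linear AND acting trivially on the line `⋀^{2n} U₊ = ⋀^r_{K ⊗_σ ℂ} V_ℂ^∨` (determinant `1`).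
[cite: MoonenZarhin1998WeilClasses, Lemma (12)(2) ("hence `g ∈ Sl_F(V)`")] -/
theorem formsStabilizer_weilHodgeCycles_eq_inf (hα : α ∈ endAlgRat Φ) (hd : 0 < d)
    (hsq : α * α = -((d : ℚ) • 1)) (hn : 0 < n) (hE : finrank ℂ E = 2 * n) :
    formsStabilizer Φ (weilHodgeCycles Φ α d n : Set (E [⋀^Fin (2 * n)]→L[ℝ] ℂ)) =
      matCentralizer α ⊓ formsStabilizer Φ
        (slotEigenForms (analyticRepReal Φ Φ (α.map (Rat.cast : ℚ → ℝ))) (sqrtNeg d) (2 * n) :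
          Set (E [⋀^Fin (2 * n)]→L[ℝ] ℂ)) := by
  rw [formsStabilizer_weilHodgeCycles_eq hα hd hsq hn hE]
  exact (inf_eq_right.2 (formsStabilizer_slotEigenForms_le_matCentralizer hα hd hsq hE)).symm

/-- A group fixing `W_K` pointwise is contained in `R(ℝ)`; e.g. (again) `Hg(X)(ℝ) ⊆ R(ℝ)` for a torus of Weil
type, now from Thm. 7.2.4 instead of Prop. 7.2.5. [cite: MoonenZarhin1998WeilClasses, Lemma (12)(2)] -/
theorem le_matCentralizer_of_le_formsStabilizer_weilHodgeCycles (hα : α ∈ endAlgRat Φ) (hd : 0 < d)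
    (hsq : α * α = -((d : ℚ) • 1)) (hn : 0 < n) (hE : finrank ℂ E = 2 * n) {G : Subgroup (SpecialLinearGroup ι ℝ)}
    (hG : G ≤ formsStabilizer Φ (weilHodgeCycles Φ α d n : Set (E [⋀^Fin (2 * n)]→L[ℝ] ℂ))) :
    G ≤ matCentralizer α :=
  hG.trans (formsStabilizer_weilHodgeCycles_le_matCentralizer hα hd hsq hn hE)

/-! ### "hence `g ∈ Sl_F(V)`": the determinant, for a torus of Weil type -/

namespace IsWeilType

variable [FiniteDimensional ℂ E]

/-- **`ρ(M)^*` fixes the Weil classes `W_K` iff `M ∈ R(ℝ)` and `det N(ρ(M)) = 1`** (`N = letterMatrix`, the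
matrix of `ρ(M)^*` on `W = U₊`, FILE B) — Lemma (12)(2) with its determinant made explicit for a complex torus
of Weil type: `Stab(W_K) = SL_K(V)(ℝ)`. [cite: MoonenZarhin1998WeilClasses, Lemma (12)(2)]
[cite: vanGeemen1994HodgeAV, 6.9 (`det(B + √-d C) = 1`) and proof of 6.10] -/
theorem mem_formsStabilizer_weilHodgeCycles_iff (h : IsWeilType Φ α d n) {M : SpecialLinearGroup ι ℝ} :
    M ∈ formsStabilizer Φ (weilHodgeCycles Φ α d n : Set (E [⋀^Fin (2 * n)]→L[ℝ] ℂ)) ↔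
      M ∈ matCentralizer α ∧ (h.letterMatrix M.1).det = 1 := by
  rw [formsStabilizer_weilHodgeCycles_eq_inf h.mem_endAlgRat h.pos h.mul_self h.pos_dim h.finrank_eq,
    Subgroup.mem_inf]
  constructor
  · rintro ⟨hR, hS⟩
    exact ⟨hR, (h.forall_compContinuousLinearMap_eq_iff_det (mem_matCentralizer_iff.1 hR)).1 hS⟩
  · rintro ⟨hR, hdet⟩
    exact ⟨hR, (h.forall_compContinuousLinearMap_eq_iff_det (mem_matCentralizer_iff.1 hR)).2 hdet⟩

omit [FiniteDimensional ℂ E] in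
/-- **`Stab(W_K) ∩ Sp(E)(ℝ) = SU_H(ℝ)`** for a torus of Weil type and any `2`-form `E` (FILE A's
`weilSpecialUnitaryGroup = U_H ∩ Stab(⋀^{2n} U₊)`, `U_H = Sp(E) ∩ R`): inside `Sp(E)`, fixing the Weil classes is
exactly membership in `SU_H`. [cite: MoonenZarhin1998WeilClasses, Lemma (12)(2)] [cite: vanGeemen1994HodgeAV, 6.9] -/
theorem formsStabilizer_weilHodgeCycles_inf_spGroup (h : IsWeilType Φ α d n) (η : E [⋀^Fin 2]→L[ℝ] ℝ) :
    formsStabilizer Φ (weilHodgeCycles Φ α d n : Set (E [⋀^Fin (2 * n)]→L[ℝ] ℂ)) ⊓ spGroup Φ η =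
      weilSpecialUnitaryGroup Φ η α d n := by
  rw [formsStabilizer_weilHodgeCycles_eq_inf h.mem_endAlgRat h.pos h.mul_self h.pos_dim h.finrank_eq]
  ext M
  simp only [Subgroup.mem_inf, mem_weilSpecialUnitaryGroup_iff, mem_weilUnitaryGroup_iff, mem_formsStabilizer_iff,
    mem_matCentralizer_iff, SetLike.mem_coe]
  tauto

end IsWeilType

end ComplexTorus

end Literature.Geometry.Kaehler
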